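import Mathlib
import Summits.Ventures.HodgeRepro2.T6N2Rich

/-!
# T6N2RichForms — THE HOST OBLIGATION OF RS-N2 IN THE OBJECTS / LAWS FORM: the ℚ-forms of the four
lines' Schwartz data as OBJECTS (a ℚ-space of admissible choices read into the line's data) with their
laws SEPARATE, and the N2 rich datum assembled from them (owner t6-p5; definition lane, no display,
no print input, no host object)

The N2 rich datum of record (`N2Rich 𝒟`, T6N2Rich p409198) takes the four admissible sets as SETS with
their ℂ-spanning. The record says what these sets ARE on the host (owner file route/T6-N2-t6-p5.md §7f,
STATUS l. 11271 (2), adopted l. 11316 (2)): for each line the admissible choices form the ℚ-vector space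
`Hom_E(A_K, A_{μ_i})_ℚ` (TIER4 B7(b) / Lemma A7.3(b)), and the admissible Schwartz data of the line are the
IMAGE of that ℚ-space under its reading into the `K`-fixed Schwartz data (Liu Thm 4.18(1) as quoted in
B7(b)) — a ℚ-FORM: closed under `0`, `+` and ℚ-scaling, ℂ-spanning, not ℂ-closed. This file types exactly
that, in the objects / laws form adopted for the host seams (t6-p3 STATUS l. 12531 (2); this seat's
T6N42FlathDatum v2 / T6N42RichHost), so that the host obligation of RS-N2 (rows 18–22 of the draft seat
map, NOT in force) reads BY NAME:

* `LineForm S` — OBJECTS of one line: the ℚ-space `Q` of admissible choices and its reading `ev : Q →+ S`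
  into the line's Schwartz data `S`; `LineForm.adm := Set.range ev` is the admissible set;
* `LineForm.IsForm` — the LAWS: `ev` is ℚ-linear (ℚ-scalars cast into ℂ) and `adm` ℂ-spans `S`
  (the `AdmSpanning` clause = N3's sentence `AdmGenerating`, owner file §7d);
* theorems of a form: `adm` contains `0`, is closed under `+`, `-` and ℚ-scaling, and is ITS OWN
  `ratSpan` (`ratSpan_adm`: the ℚ-form property of T6N2RatForm as a fixed point, via the general
  `ratSpan_subset_of_closed`);
* `N2Forms 𝒟` — the four line forms over an N3 datum (objects) and `N2Forms.IsForm` (laws);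
* `N2Rich.ofForms Fm h : N2Rich 𝒟` — THE HOST N2 RICH DATUM from the forms, with `ofForms_admA … = rfl`,
  `ofForms_toDatum = rfl`, and the N2 block of a composition on the carrier `NAut3` in the forms'
  binders: `N2_block_forms₃ M Fm h hR : M.AdmDatum ∧ M.d2.AdmGenerating`, `explicitShape_forms₃`,
  `admData_forms₃_iff`, `ofNAut_ofForms_block`;
* the instance of the host-faithful shape (§10.5(ii)(c)): `LineForm.ofBasis b` — the ℚ-form of a ℂ-basis
  `b` of the line's data (`Q := ι →₀ ℚ`, `ev := Σ q_i b_i`), with `isForm_ofBasis` and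
  `ofBasis_adm : (ofBasis b).adm = ratSpan (Set.range b)`, so that `N2Rich.ofForms` at four bases IS the
  `N2Rich.ofBases` of record (`ofForms_ofBases`); its §7f shape is complete in kernel: ℚ-closed
  (`ratSpan_adm`), ℂ-spanning (`isForm_ofBasis`), NOT ℂ-closed (`I_smul_basis_not_mem_adm_ofBasis`,
  `adm_ofBasis_not_smul_closed`), countable for a countable basis (`adm_ofBasis_countable`).

HOST OBLIGATION OF RS-N2 BY NAME (per line): 1 DATA (`LineForm` — the ℚ-space of admissible choices with
its reading) + 1 RESIDUAL (`IsForm` — ℚ-linearity of the reading, ℂ-spanning of its image); the assembly's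
`hR : M.d2 = (N2Rich.ofForms Fm h).toDatum F P` as before (class EX, construction). Nothing on the M2 line
of record changes; nothing here is consumed by any theorem of record; every proof is a T6N2Rich /
T6N2RatForm theorem applied to `Set.range ev`, plus the `Finsupp` bookkeeping of `ratSpan`.

README §8(d): uses an L-value-free non-vanishing device: NO (TIER5 §N2, a pre-02:16Z line of record —
N2 asserts no non-vanishing — continued).
Filed in Tier-6 WAVE 1 as p437518 (2026-08-26T10:15:18Z, commit 1c96fa59005f); v2 = docstring-only.
-/

namespace Summit.Ventures.HodgeRepro2.T6

open Summit.Ventures.HodgeRepro2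
open Summit.Ventures.HodgeRepro2.T6.N2ToyIsoS
open Summit.Ventures.HodgeRepro2.T6.N2RatForm

/-! ## 1. `ratSpan` bookkeeping (T6N2RatForm continued): monotone, and a fixed point on closed sets -/

section RatSpan

variable {V : Type*} [AddCommGroup V] [Module ℂ V]

/-- `ratSpan` is monotone. -/
theorem ratSpan_mono {S T : Set V} (hST : S ⊆ T) : ratSpan S ⊆ ratSpan T := by
  rintro x ⟨l, hl, rfl⟩
  exact ⟨l, hl.trans hST, rfl⟩

/-- A set containing `0` and closed under `+` and ℚ-scaling contains its `ratSpan` (induction on the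
finitely supported coefficient function). -/
theorem ratSpan_subset_of_closed {S : Set V} (h0 : (0 : V) ∈ S)
    (hadd : ∀ x y, x ∈ S → y ∈ S → x + y ∈ S)
    (hsmul : ∀ (q : ℚ) (x : V), x ∈ S → (q : ℂ) • x ∈ S) : ratSpan S ⊆ S := by
  classical
  rintro x ⟨l, hl, rfl⟩
  induction l using Finsupp.induction with
  | zero => simpa using h0
  | single_add a b f ha hb ih =>
    have hdisj : Disjoint (Finsupp.single a b).support f.support := by
      rw [Finsupp.support_single a hb]
      simpa using ha
    rw [Finsupp.support_add_eq hdisj, Finset.coe_union, Set.union_subset_iff] at hl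
    rw [Finsupp.sum_add_index' (fun v => by simp) (fun v q₁ q₂ => by simp [add_smul]),
      Finsupp.sum_single_index (by simp)]
    refine hadd _ _ (hsmul b a ?_) (ih hl.2)
    have h1 := hl.1
    rw [Finsupp.support_single a hb] at h1
    simpa using h1

/-- A set containing `0` and closed under `+` and ℚ-scaling is its own `ratSpan`. -/
theorem ratSpan_eq_self_of_closed {S : Set V} (h0 : (0 : V) ∈ S)
    (hadd : ∀ x y, x ∈ S → y ∈ S → x + y ∈ S)
    (hsmul : ∀ (q : ℚ) (x : V), x ∈ S → (q : ℂ) • x ∈ S) : ratSpan S = S :=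
  Set.Subset.antisymm (ratSpan_subset_of_closed h0 hadd hsmul) (subset_ratSpan S)

end RatSpan

/-! ## 2. A line form: the ℚ-space of admissible choices read into the line's Schwartz data -/

/-- A ℚ-FORM OF ONE LINE'S SCHWARTZ DATA, as OBJECTS: the ℚ-vector space `Q` of the line's admissible
choices (the record's `Hom_E(A_K, A_{μ_i})_ℚ`, TIER4 B7(b) / Lemma A7.3(b)) and its additive reading
`ev` into the line's Schwartz data `S` (the image of the admissible choices in the `K`-fixed Schwartz data,
Liu Thm 4.18(1) as quoted in B7(b)). The laws are `LineForm.IsForm`. -/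
structure LineForm (S : Type) [AddCommGroup S] [Module ℂ S] where
  /-- the ℚ-space of admissible choices of the line -/
  Q : Type
  [instAddCommGroupQ : AddCommGroup Q]
  [instModuleQ : Module ℚ Q]
  /-- the reading of an admissible choice as Schwartz data of the line -/
  ev : Q →+ S

namespace LineForm

variable {S : Type} [AddCommGroup S] [Module ℂ S] (L : LineForm S)

/-- the additive structure of the space of admissible choices (field) -/
instance : AddCommGroup L.Q := L.instAddCommGroupQ
/-- the ℚ-structure of the space of admissible choices (field) -/
instance : Module ℚ L.Q := L.instModuleQ

/-- THE ADMISSIBLE SCHWARTZ DATA OF THE LINE: the image of the admissible choices. -/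
def adm : Set S := Set.range L.ev

/-- `x ∈ L.adm ↔ ∃ a, L.ev a = x`. -/
theorem mem_adm_iff (x : S) : x ∈ L.adm ↔ ∃ a, L.ev a = x := Iff.rfl

/-- THE LAWS OF A LINE FORM (separate from its objects, the form of record): the reading is ℚ-linear
(ℚ-scalars cast into ℂ), and the admissible data ℂ-span the line's Schwartz space (the `AdmSpanning`
clause of the N2 datum = N3's sentence `AdmGenerating`). -/
structure IsForm : Prop where
  /-- the reading is ℚ-linear -/
  ratSmul : ∀ (q : ℚ) (a : L.Q), L.ev (q • a) = (q : ℂ) • L.ev a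
  /-- the admissible data ℂ-span the line -/
  spans : Submodule.span ℂ L.adm = ⊤

/-- `0 ∈ L.adm`. -/
theorem zero_mem_adm : (0 : S) ∈ L.adm := ⟨0, map_zero _⟩

/-- `L.adm` is closed under addition. -/
theorem add_mem_adm {x y : S} (hx : x ∈ L.adm) (hy : y ∈ L.adm) : x + y ∈ L.adm := by
  obtain ⟨a, rfl⟩ := hx
  obtain ⟨b, rfl⟩ := hy
  exact ⟨a + b, map_add _ _ _⟩

/-- `L.adm` is closed under negation. -/
theorem neg_mem_adm {x : S} (hx : x ∈ L.adm) : -x ∈ L.adm := by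
  obtain ⟨a, rfl⟩ := hx
  exact ⟨-a, map_neg _ _⟩

/-- Under the laws, `L.adm` is closed under ℚ-scaling (ℚ-scalars cast into ℂ). -/
theorem ratSmul_mem_adm (h : L.IsForm) (q : ℚ) {x : S} (hx : x ∈ L.adm) : (q : ℂ) • x ∈ L.adm := by
  obtain ⟨a, rfl⟩ := hx
  exact ⟨q • a, h.ratSmul q a⟩

/-- THE ℚ-FORM PROPERTY: under the laws, the admissible set is its own `ratSpan` (T6N2RatForm). -/
theorem ratSpan_adm (h : L.IsForm) : ratSpan L.adm = L.adm :=
  ratSpan_eq_self_of_closed L.zero_mem_adm (fun _ _ hx hy => L.add_mem_adm hx hy)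
    (fun q _ hx => L.ratSmul_mem_adm h q hx)

/-- Under the laws, the ℂ-span of the admissible set is everything (`IsForm.spans` read through
`ratSpan`, T6N2RatForm `span_ratSpan`). -/
theorem span_ratSpan_adm (h : L.IsForm) : Submodule.span ℂ (ratSpan L.adm) = ⊤ := by
  rw [span_ratSpan]
  exact h.spans

/-! ### The instance of the host-faithful shape: the ℚ-form of a ℂ-basis -/

section ofBasis

variable {ι : Type} (b : Module.Basis ι ℂ S)

/-- The additive map `q ↦ (q : ℂ) • b i` of one basis vector. -/
noncomputable def basisTerm (i : ι) : ℚ →+ S where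
  toFun q := (q : ℂ) • b i
  map_zero' := by simp
  map_add' q₁ q₂ := by simp [add_smul]

/-- `basisTerm b i q = (q : ℂ) • b i`. -/
@[simp] theorem basisTerm_apply (i : ι) (q : ℚ) : basisTerm b i q = (q : ℂ) • b i := rfl

/-- THE LINE FORM OF A ℂ-BASIS: admissible choices `Q := ι →₀ ℚ`, read as `Σ_i q_i b_i`. -/
noncomputable def ofBasis : LineForm S where
  Q := ι →₀ ℚ
  ev := Finsupp.liftAddHom (basisTerm b)

/-- `(ofBasis b).ev l = l.sum (fun i q => (q : ℂ) • b i)`. -/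
theorem ofBasis_ev_apply (l : ι →₀ ℚ) : (ofBasis b).ev l = l.sum fun i q => (q : ℂ) • b i := by
  show Finsupp.liftAddHom (basisTerm b) l = _
  rw [Finsupp.liftAddHom_apply]
  rfl

/-- Every basis vector is admissible for `ofBasis b`. -/
theorem basis_mem_adm_ofBasis (i : ι) : b i ∈ (ofBasis b).adm :=
  ⟨Finsupp.single i 1, by simp [ofBasis_ev_apply]⟩

/-- The reading of a basis is ℚ-linear (stated on `ι →₀ ℚ` with its standard ℚ-structure). -/
theorem liftAddHom_basisTerm_smul (q : ℚ) (l : ι →₀ ℚ) :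
    Finsupp.liftAddHom (basisTerm b) (q • l) = (q : ℂ) • Finsupp.liftAddHom (basisTerm b) l := by
  rw [Finsupp.liftAddHom_apply, Finsupp.liftAddHom_apply,
    Finsupp.sum_smul_index' (fun i => by simp), Finsupp.smul_sum]
  refine Finsupp.sum_congr fun i _ => ?_
  simp [smul_eq_mul, mul_smul]

/-- THE LAWS HOLD for the ℚ-form of a basis: ℚ-linearity of the reading, and ℂ-spanning (the basis
vectors are admissible). -/
theorem isForm_ofBasis : (ofBasis b).IsForm where
  ratSmul q l := liftAddHom_basisTerm_smul b q l
  spans := by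
    refine eq_top_iff.mpr ?_
    rw [← b.span_eq]
    exact Submodule.span_mono (Set.range_subset_iff.mpr (basis_mem_adm_ofBasis b))

/-- `(ofBasis b).adm ⊆ ratSpan (Set.range b)` (the reading of `l` is the `ratSpan` combination with
coefficients `l` transported along `b`). -/
theorem adm_ofBasis_subset_ratSpan : (ofBasis b).adm ⊆ ratSpan (Set.range b) := by
  classical
  rintro x ⟨l, rfl⟩
  refine ⟨Finsupp.mapDomain b l, ?_, ?_⟩
  · intro v hv
    have hv' := Finsupp.mapDomain_support hv
    obtain ⟨i, -, rfl⟩ := Finset.mem_image.mp hv'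
    exact ⟨i, rfl⟩
  · rw [ofBasis_ev_apply, Finsupp.sum_mapDomain_index (fun i => by simp) (fun i q₁ q₂ => by simp [add_smul])]

/-- THE ADMISSIBLE SET OF THE ℚ-FORM OF A BASIS IS THE RECORD'S `ratSpan (Set.range b)` (T6N2RatForm). -/
theorem ofBasis_adm : (ofBasis b).adm = ratSpan (Set.range b) := by
  refine Set.Subset.antisymm (adm_ofBasis_subset_ratSpan b) ?_
  calc ratSpan (Set.range b) ⊆ ratSpan (ofBasis b).adm :=
        ratSpan_mono (Set.range_subset_iff.mpr (basis_mem_adm_ofBasis b))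
    _ = (ofBasis b).adm := (ofBasis b).ratSpan_adm (isForm_ofBasis b)

/-- THE ℚ-FORM OF A BASIS IS NOT ℂ-CLOSED: `I • b i` is not admissible (T6N2RatForm
`I_smul_basis_not_mem_ratSpan`) — the record's «not closed under ℂ-scaling» (owner file §7f). -/
theorem I_smul_basis_not_mem_adm_ofBasis (i : ι) : Complex.I • b i ∉ (ofBasis b).adm := by
  rw [ofBasis_adm]
  exact I_smul_basis_not_mem_ratSpan b i

/-- … hence `(ofBasis b).adm` is not closed under ℂ-scaling (the exact negation of the `hsmul` binder
of t6-p1's `nAut2_displays_false_of_admA_smul_closed`, as T6N2RatForm `ratSpan_range_not_smul_closed`). -/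
theorem adm_ofBasis_not_smul_closed [Nonempty ι] :
    ¬ ∀ (t : ℂ) (x : S), x ∈ (ofBasis b).adm → t • x ∈ (ofBasis b).adm := by
  rw [ofBasis_adm]
  exact ratSpan_range_not_smul_closed b

/-- For a countable basis the admissible set is countable (the periods over admissible data lie in a
countable set — t6-p1's `Λ`; T6N2RatForm `ratSpan_range_countable`). -/
theorem adm_ofBasis_countable [Countable ι] : (ofBasis b).adm.Countable := by
  rw [ofBasis_adm]
  exact ratSpan_range_countable b

end ofBasis

end LineForm

/-! ## 3. The four line forms over an N3 datum, and the N2 rich datum assembled from them -/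

/-- THE FOUR LINE FORMS over an N3 datum — the OBJECTS of the host's N2 rich datum: one ℚ-form per line
(`111` = side A first factor, `100` = side A second factor, `101` = side B first, `110` = side B second). -/
structure N2Forms (𝒟 : N3Datum) where
  /-- the ℚ-form of line `111` -/
  A : LineForm 𝒟.A.Sa
  /-- the ℚ-form of line `100` -/
  B : LineForm 𝒟.A.Sb
  /-- the ℚ-form of line `101` -/
  C : LineForm 𝒟.B.Sa
  /-- the ℚ-form of line `110` -/
  D : LineForm 𝒟.B.Sb

namespace N2Forms

variable {𝒟 : N3Datum} (Fm : N2Forms 𝒟)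

/-- THE LAWS of the four line forms (separate from the objects). -/
structure IsForm : Prop where
  /-- line `111` -/
  A : Fm.A.IsForm
  /-- line `100` -/
  B : Fm.B.IsForm
  /-- line `101` -/
  C : Fm.C.IsForm
  /-- line `110` -/
  D : Fm.D.IsForm

/-- The four ℚ-forms of four ℂ-bases of the lines' Schwartz spaces (the host-faithful shape). -/
noncomputable def ofBases {ιA ιB ιC ιD : Type} (bA : Module.Basis ιA ℂ 𝒟.A.Sa)
    (bB : Module.Basis ιB ℂ 𝒟.A.Sb) (bC : Module.Basis ιC ℂ 𝒟.B.Sa)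
    (bD : Module.Basis ιD ℂ 𝒟.B.Sb) : N2Forms 𝒟 :=
  ⟨LineForm.ofBasis bA, LineForm.ofBasis bB, LineForm.ofBasis bC, LineForm.ofBasis bD⟩

/-- The laws hold for the forms of four bases. -/
theorem isForm_ofBases {ιA ιB ιC ιD : Type} (bA : Module.Basis ιA ℂ 𝒟.A.Sa)
    (bB : Module.Basis ιB ℂ 𝒟.A.Sb) (bC : Module.Basis ιC ℂ 𝒟.B.Sa)
    (bD : Module.Basis ιD ℂ 𝒟.B.Sb) : (ofBases bA bB bC bD).IsForm :=
  ⟨LineForm.isForm_ofBasis bA, LineForm.isForm_ofBasis bB, LineForm.isForm_ofBasis bC,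
    LineForm.isForm_ofBasis bD⟩

end N2Forms

namespace N2Rich

variable {K : Type*} [Field K] [NumberField K] [NumberField.IsCMField K]
variable {𝒟 : N3Datum} (Fm : N2Forms 𝒟) (h : Fm.IsForm) (F : FaceSetting K) (P : NDatum F)

/-- THE HOST N2 RICH DATUM FROM THE FOUR LINE FORMS under their laws: the admissible sets are the
images of the admissible choices, the spanning fields are the laws' `spans`. -/
def ofForms : N2Rich 𝒟 :=
  ⟨Fm.A.adm, Fm.B.adm, Fm.C.adm, Fm.D.adm, h.A.spans, h.B.spans, h.C.spans, h.D.spans⟩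

/-- The admissible set of line `111` is the image of its admissible choices (`rfl`). -/
theorem ofForms_admA : (ofForms Fm h).admA = Set.range Fm.A.ev := rfl

/-- The admissible set of line `100` is the image of its admissible choices (`rfl`). -/
theorem ofForms_admB : (ofForms Fm h).admB = Set.range Fm.B.ev := rfl

/-- The admissible set of line `101` is the image of its admissible choices (`rfl`). -/
theorem ofForms_admC : (ofForms Fm h).admC = Set.range Fm.C.ev := rfl

/-- The admissible set of line `110` is the image of its admissible choices (`rfl`). -/
theorem ofForms_admD : (ofForms Fm h).admD = Set.range Fm.D.ev := rfl

/-- The constructed N2 datum of the forms is `toyIsoSF` at the four images (`rfl`). -/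
theorem ofForms_toDatum :
    (ofForms Fm h).toDatum F P = toyIsoSF F P 𝒟 Fm.A.adm Fm.B.adm Fm.C.adm Fm.D.adm := rfl

/-- Each admissible set of the forms' datum is a ℚ-form (its own `ratSpan`): line `111`. -/
theorem ratSpan_ofForms_admA : ratSpan (ofForms Fm h).admA = (ofForms Fm h).admA :=
  Fm.A.ratSpan_adm h.A

/-- Line `100`. -/
theorem ratSpan_ofForms_admB : ratSpan (ofForms Fm h).admB = (ofForms Fm h).admB :=
  Fm.B.ratSpan_adm h.B

/-- Line `101`. -/
theorem ratSpan_ofForms_admC : ratSpan (ofForms Fm h).admC = (ofForms Fm h).admC :=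
  Fm.C.ratSpan_adm h.C

/-- Line `110`. -/
theorem ratSpan_ofForms_admD : ratSpan (ofForms Fm h).admD = (ofForms Fm h).admD :=
  Fm.D.ratSpan_adm h.D

/-- N2's conclusion on the forms' datum, no hypothesis beyond the laws. -/
theorem ofForms_toDatum_adm : ((ofForms Fm h).toDatum F P).Adm :=
  (ofForms Fm h).toDatum_adm F P

/-- The sentence N2 and N3 share on the forms' datum. -/
theorem ofForms_toDatum_admGenerating : ((ofForms Fm h).toDatum F P).AdmGenerating :=
  (ofForms Fm h).toDatum_admGenerating F P

/-- THE `ofBases` INSTANCE OF RECORD IS AN `ofForms` INSTANCE: at the forms of four bases the assembled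
rich datum is `N2Rich.ofBases` (T6N2Rich), through `LineForm.ofBasis_adm`. -/
theorem ofForms_ofBases {ιA ιB ιC ιD : Type} (bA : Module.Basis ιA ℂ 𝒟.A.Sa)
    (bB : Module.Basis ιB ℂ 𝒟.A.Sb) (bC : Module.Basis ιC ℂ 𝒟.B.Sa)
    (bD : Module.Basis ιD ℂ 𝒟.B.Sb) :
    ofForms (N2Forms.ofBases bA bB bC bD) (N2Forms.isForm_ofBases bA bB bC bD) =
      N2Rich.ofBases bA bB bC bD := by
  simp only [ofForms, N2Forms.ofBases, N2Rich.ofBases, LineForm.ofBasis_adm]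

variable {F P}

/-! ### The N2 block of a composition on the carrier `NAut3`, in the forms' binders -/

/-- THE WHOLE N2 BLOCK OF v6 (`M.AdmDatum` and `hAdm`) on a carrier whose N2 datum is assembled from the
four line forms: the binders are the forms (DATA), their laws (RESIDUAL) and the construction
equation `hR` (EX). -/
theorem N2_block_forms₃ (M : NAut3 F P) (Fm : N2Forms M.d3) (h : Fm.IsForm)
    (hR : M.d2 = (ofForms Fm h).toDatum F P) : M.AdmDatum ∧ M.d2.AdmGenerating :=
  N2_block_rich₃ M (ofForms Fm h) hR

/-- `N2_main` in the forms' binders. -/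
theorem N2_main_forms₃ (M : NAut3 F P) (Fm : N2Forms M.d3) (h : Fm.IsForm)
    (hR : M.d2 = (ofForms Fm h).toDatum F P) : M.AdmDatum :=
  N2_main_rich₃ M (ofForms Fm h) hR

/-- `hAdm` in the forms' binders. -/
theorem admGenerating_forms₃ (M : NAut3 F P) (Fm : N2Forms M.d3) (h : Fm.IsForm)
    (hR : M.d2 = (ofForms Fm h).toDatum F P) : M.d2.AdmGenerating :=
  admGenerating_rich₃ M (ofForms Fm h) hR

/-- The four EX binders of v6 in the forms' binders. -/
theorem explicitShape_forms₃ (M : NAut3 F P) (Fm : N2Forms M.d3) (h : Fm.IsForm)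
    (hR : M.d2 = (ofForms Fm h).toDatum F P) : N2Contract3.ExplicitShape M :=
  explicitShape_rich₃ M (ofForms Fm h) hR

/-- The carrier's admissible quadruples are the readings of admissible choices of the four lines. -/
theorem admData_forms₃_iff (M : NAut3 F P) (Fm : N2Forms M.d3) (h : Fm.IsForm)
    (hR : M.d2 = (ofForms Fm h).toDatum F P) (φ : M.d3.A.Sa × M.d3.A.Sb × M.d3.B.Sa × M.d3.B.Sb) :
    M.AdmData φ ↔
      (∃ a, Fm.A.ev a = φ.1) ∧ (∃ a, Fm.B.ev a = φ.2.1) ∧ (∃ a, Fm.C.ev a = φ.2.2.1) ∧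
        ∃ a, Fm.D.ev a = φ.2.2.2 :=
  admData_rich₃_iff M (ofForms Fm h) hR φ

/-- A v1 carrier with the forms' datum adjoined satisfies the construction equation by `rfl`, hence has
N2's conclusion and N3's sentence with no hypothesis beyond the laws. -/
theorem ofNAut_ofForms_block (M₁ : NAut F P) (Fm : N2Forms M₁.d3) (h : Fm.IsForm) :
    (NAut3.ofNAut M₁ ((ofForms Fm h).toDatum F P)).AdmDatum ∧
      (NAut3.ofNAut M₁ ((ofForms Fm h).toDatum F P)).d2.AdmGenerating :=
  ofNAut_toDatum_block M₁ (ofForms Fm h)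

end N2Rich

end Summit.Ventures.HodgeRepro2.T6
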